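import Literature.NumberTheory.EllipticCurves.SteinWuthrich2013.MultiplicativeLeadingTerm
import Literature.NumberTheory.EllipticCurves.TateCurve.UniformizationThetaZeros
import HarnessLib

/-!
# Stein–Wuthrich 2013 §4.2: the squared Tate sigma function is `θ(u,q)²/u`
# (`tateSigmaSq q ((u + u⁻¹)/2) = tateTheta q u ^ 2 / u`; proofs only)

Topic `Literature/NumberTheory/EllipticCurves` (cluster `SteinWuthrich2013`); proof file (theorems
only, nothing asserted, no definition). Cell `bsd-eis`, seat `bsd-eis-k5-c4` g3 — one of the
inputs (T3) of the discharge of the named facts `exists_isMultCanonical` /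
`exists_isSplitMultCanonical` (`MultiplicativeHeightExistence.lean`; crux 4 `BSDpOnCellC` of route
`EisensteinPrimes`, stmt-BirchSwinnertonDyer-19034, `stub_publishedFacts` conjuncts `hHs`/`hHn`):
the hypothesis `hυσ` of `tateSigma_theta_of_uniformization`
(`MultiplicativeHeightThetaOfUniformizationProofs.lean`) reads
`tateSigmaSq q (coshOfSq (logUnitParamSq …)) = θ(υ,q)²/υ`, and `coshOfSq (log_p(u)²) = (u + u⁻¹)/2`;
this file supplies the `q`-product half of that identity.

Stein–Wuthrich 2013 §4.2 (p. 15): "`σ_p(u) = (u−1)/u^{1/2} · ∏_{n≥1} (1 − q_E^n u)(1 − q_E^n/u)/(1 − q_E^n)²`",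
so `σ_p(u)² = (u−1)²/u · ∏ ((1−qⁿu)(1−qⁿu⁻¹))²/(1−qⁿ)⁴ = θ(u,q)²/u` with Silverman's
`θ(u,q) = (1−u)∏_{n≥1}(1−qⁿu)(1−qⁿu⁻¹)/(1−qⁿ)²` (ATAEC Prop. V.3.2; tree `TateCurve.tateTheta`),
while the tree's transcription `tateSigmaSq q c = 2(c−1)·∏ (1 − 2qⁿc + q^{2n})²/(1−qⁿ)⁴`
(`MultiplicativeLeadingTerm.lean`) is `σ_p(u)²` written through `c = (u + u⁻¹)/2`
(`(u−1)²/u = 2(c−1)`, `(1−qⁿu)(1−qⁿu⁻¹) = 1 − 2qⁿc + q^{2n}`). Main results, over any complete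
normed field `L` with `‖q‖ < 1`, `u ≠ 0`:

* `hasProd_inv_of_ne_zero` — in a normed field, `HasProd f a` with `a ≠ 0` gives
  `HasProd f⁻¹ a⁻¹` (inversion is continuous at `a ≠ 0`);
* `hasProd_tateSigmaSq_factor` — the factors of `tateSigmaSq q ((u+u⁻¹)/2)` have product
  `(P(u) P(u⁻¹))² / P(1)⁴`, `P(v) = ∏_{n≥1}(1 − qⁿv) = TateCurve.tateP q v`;
* `tateSigmaSq_cosh_eq` — **`tateSigmaSq q ((u + u⁻¹)/2) = tateTheta q u ^ 2 / u`**.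

## Sources

* W. Stein, C. Wuthrich, *Algorithms for the arithmetic of elliptic curves using Iwasawa theory*,
  Math. Comp. 82 (2013), §4.2 p. 15 (display of `σ_p(u)`). [SteinWuthrich2013]
* J. H. Silverman, *Advanced Topics in the Arithmetic of Elliptic Curves* (1994), Prop. V.3.2
  (PDF p. 399). [SilvermanATAEC1994]
-/

noncomputable section

open Filter Topology

open Literature.NumberTheory.EllipticCurves.TateCurve

namespace Literature.NumberTheory.EllipticCurves.SteinWuthrich2013

variable {L : Type*} [NormedField L]

/-- In a normed field, if `∏ f = a` (unconditionally) with `a ≠ 0` then `∏ f⁻¹ = a⁻¹`: the finite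
partial products of `f⁻¹` are the inverses of those of `f`, and inversion is continuous at `a ≠ 0`.
[folklore] -/
private theorem hasProd_inv_of_ne_zero {f : ℕ → L} {a : L} (h : HasProd f a) (ha : a ≠ 0) :
    HasProd (fun n => (f n)⁻¹) a⁻¹ := by
  unfold HasProd at h ⊢
  have := h.inv₀ ha
  refine this.congr fun s => ?_
  exact (Finset.prod_inv_distrib (s := s) (f := f)).symm

/-- **The factors of `tateSigmaSq` at `c = (u + u⁻¹)/2` have product `(P(u)P(u⁻¹))²/P(1)⁴`**,
`P(v) = ∏_{n≥1}(1 − qⁿv)`: since `1 − 2qⁿc + q^{2n} = (1 − qⁿu)(1 − qⁿu⁻¹)` for `u ≠ 0` (and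
`2 ≠ 0`), the factor is `((1−qⁿu)(1−qⁿu⁻¹))² · ((1−qⁿ)⁴)⁻¹`, and the four products converge
(`TateCurve.hasProd_tateP`; `P(1) ≠ 0` by `TateCurve.tateP_one_ne_zero`). [Stein–Wuthrich 2013,
§4.2 (p. 15); Silverman ATAEC Prop. V.3.2 (a)] [cite: SteinWuthrich2013, §4.2 (p. 15)] -/
theorem hasProd_tateSigmaSq_factor [CompleteSpace L] {q : L} (hq : ‖q‖ < 1) {u : L} (hu : u ≠ 0)
    (h2 : (2 : L) ≠ 0) :
    HasProd (fun n : ℕ => (1 - 2 * q ^ (n + 1) * ((u + u⁻¹) / 2) + q ^ (2 * (n + 1))) ^ 2 /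
        (1 - q ^ (n + 1)) ^ 4)
      ((tateP q u * tateP q u⁻¹) ^ 2 / tateP q 1 ^ 4) := by
  have hPu := hasProd_tateP hq u
  have hPui := hasProd_tateP hq u⁻¹
  have hP1 := hasProd_tateP hq (1 : L)
  have hP10 : tateP q (1 : L) ≠ 0 := tateP_one_ne_zero hq
  have hnum : HasProd (fun n : ℕ => ((1 - q ^ (n + 1) * u) * (1 - q ^ (n + 1) * u⁻¹)) ^ 2)
      ((tateP q u * tateP q u⁻¹) ^ 2) := (hPu.mul hPui).pow 2
  have hden : HasProd (fun n : ℕ => ((1 - q ^ (n + 1) * 1) ^ 4)⁻¹) (tateP q 1 ^ 4)⁻¹ :=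
    hasProd_inv_of_ne_zero (hP1.pow 4) (pow_ne_zero 4 hP10)
  have hall := hnum.mul hden
  rw [← div_eq_mul_inv] at hall
  have hfun : (fun n : ℕ => (1 - 2 * q ^ (n + 1) * ((u + u⁻¹) / 2) + q ^ (2 * (n + 1))) ^ 2 /
      (1 - q ^ (n + 1)) ^ 4) = fun n : ℕ =>
        ((1 - q ^ (n + 1) * u) * (1 - q ^ (n + 1) * u⁻¹)) ^ 2 * ((1 - q ^ (n + 1) * 1) ^ 4)⁻¹ := by
    funext n
    rw [mul_one, ← div_eq_mul_inv]
    congr 1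
    have hfac : 1 - 2 * q ^ (n + 1) * ((u + u⁻¹) / 2) + q ^ (2 * (n + 1)) =
        (1 - q ^ (n + 1) * u) * (1 - q ^ (n + 1) * u⁻¹) := by
      have h22 : 2 * q ^ (n + 1) * ((u + u⁻¹) / 2) = q ^ (n + 1) * (u + u⁻¹) := by
        field_simp
      rw [h22]
      have : u * u⁻¹ = 1 := mul_inv_cancel₀ hu
      linear_combination -(q ^ (n + 1)) ^ 2 * this
    rw [hfac]
  rw [hfun]
  exact hall

/-- **`σ_q(u)² = θ(u,q)²/u`: the tree's `tateSigmaSq` at `c = (u + u⁻¹)/2` is the square of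
Silverman's theta function divided by `u`** (`‖q‖ < 1`, `u ≠ 0`, `2 ≠ 0`, complete field):
`tateSigmaSq q ((u+u⁻¹)/2) = 2(c−1)·(P(u)P(u⁻¹))²/P(1)⁴ = ((1−u)²/u)·(P(u)P(u⁻¹))²/P(1)⁴ = θ(u,q)²/u`
with `θ(u,q) = (1−u)P(u)P(u⁻¹)/P(1)²` (`TateCurve.tateTheta`). This is SW's
"`σ_p(u) = (u−1)/u^{1/2}·∏(1−qⁿu)(1−qⁿ/u)/(1−qⁿ)²`" squared. [Stein–Wuthrich 2013, §4.2 (p. 15);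
Silverman ATAEC Prop. V.3.2] [cite: SteinWuthrich2013, §4.2 (p. 15)]
[cite: SilvermanATAEC1994, Prop. V.3.2 (PDF p. 399)] -/
theorem tateSigmaSq_cosh_eq [CompleteSpace L] {q : L} (hq : ‖q‖ < 1) {u : L} (hu : u ≠ 0)
    (h2 : (2 : L) ≠ 0) : tateSigmaSq q ((u + u⁻¹) / 2) = tateTheta q u ^ 2 / u := by
  have hP10 : tateP q (1 : L) ≠ 0 := tateP_one_ne_zero hq
  unfold tateSigmaSq
  rw [(hasProd_tateSigmaSq_factor hq hu h2).tprod_eq]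
  unfold tateTheta
  have h21 : 2 * ((u + u⁻¹) / 2 - 1) = (1 - u) ^ 2 / u := by
    field_simp
    ring
  rw [h21]
  field_simp

end Literature.NumberTheory.EllipticCurves.SteinWuthrich2013

end
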